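import Summits.CriticalPhenomena.PercolationContinuityZ3.Theorems.SahiAEPlanePrelim
import Summits.CriticalPhenomena.PercolationContinuityZ3.Theorems.SahiAECornerEnvelopeLocal
import Summits.CriticalPhenomena.PercolationContinuityZ3.Theorems.SahiAEBoxExtensionCoord
import Mathlib.MeasureTheory.Function.SpecialFunctions.Basic

/-!
# The planar structure theorem, quadrant step: a monotone supermodular version of the double increment

Support file of the Sahi cell (`prim-sahi`, typer seat, generation 22; `--supports stmt-CriticalPhenomena-4575`).
Theorems only (no definitions, no named facts, no sorries).

Let `φ : ℝ² → ℝ` (`ℝ² = Fin 2 → ℝ`) be measurable and satisfy the rectangle inequality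
`φ(x₀∧y₀, x₁∨y₁) + φ(x₀∨y₀, x₁∧y₁) ≤ φ(x ∧ y) + φ(x ∨ y)` for `λ² ⊗ λ²`-a.e. `(x, y)` (the a.e. form of
supermodularity, `Plane.ae_rect_of_ae_supermodular`).  NO boundedness is assumed.  For a base point `b = (s₀, t₀)`
consider the double increment

  `D_b(x) = φ(x) − φ(x₀, t₀) − φ(s₀, x₁) + φ(s₀, t₀)`,

which has the same rectangle increments as `φ` and vanishes on the cross `{x₀ = s₀} ∪ {x₁ = t₀}`.  For almost every
`b` (generic coordinates, Fubini): on the open quadrant `Q = {x₀ > s₀, x₁ > t₀}` the function `D_b` is a.e.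
non-negative, a.e. non-decreasing on comparable pairs and a.e. supermodular, and essentially bounded below every point
(by its value at a generic larger point); the lower-corner envelope of `𝟙_Q · exp D_b`
(`exists_measurable_monotone_mtp2_version_of_ae_local`) then gives

* `Plane.quadrant_version` — for a.e. `b` a measurable `G : ℝ² → ℝ` with `G = D_b` a.e. on `Q`, supermodular at
  EVERY pair of `Q`, non-decreasing at EVERY comparable pair of `Q`, and `G ≥ 0` on `Q`.

`SahiAEPlane.lean` glues four such quadrant versions (obtained from `φ` and its reflections) along the cross.
No sorries, no new axioms.
-/

noncomputable section

namespace Summit.CriticalPhenomena.PercolationContinuityZ3.Theorems.SahiAEFourFunctions.Plane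

open MeasureTheory Set Filter Topology Function
open scoped ENNReal NNReal

/-- A point of the plane is the vector of its two coordinates. [folklore] -/
private theorem eta' (x : Fin 2 → ℝ) : x = ![x 0, x 1] := by
  ext i; fin_cases i <;> rfl

/-- First coordinate of an explicit point. [folklore] -/
@[simp] private theorem vec_zero' (s t : ℝ) : (![s, t] : Fin 2 → ℝ) 0 = s := rfl

/-- Second coordinate of an explicit point. [folklore] -/
@[simp] private theorem vec_one' (s t : ℝ) : (![s, t] : Fin 2 → ℝ) 1 = t := rfl

/-- `x ↦ (x₀, t)` is measurable. [folklore] -/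
theorem measurable_vec_fst (t : ℝ) : Measurable fun x : Fin 2 → ℝ => (![x 0, t] : Fin 2 → ℝ) := by
  refine measurable_pi_iff.2 fun i => ?_
  fin_cases i
  · exact measurable_pi_apply 0
  · exact measurable_const

/-- `x ↦ (s, x₁)` is measurable. [folklore] -/
theorem measurable_vec_snd (s : ℝ) : Measurable fun x : Fin 2 → ℝ => (![s, x 1] : Fin 2 → ℝ) := by
  refine measurable_pi_iff.2 fun i => ?_
  fin_cases i
  · exact measurable_const
  · exact measurable_pi_apply 1

/-- The open quadrant `{x₀ > s₀, x₁ > t₀}` is measurable. [folklore] -/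
theorem measurableSet_quadrant (b : Fin 2 → ℝ) : MeasurableSet {x : Fin 2 → ℝ | b 0 < x 0 ∧ b 1 < x 1} :=
  (measurableSet_lt measurable_const (measurable_pi_apply 0)).inter
    (measurableSet_lt measurable_const (measurable_pi_apply 1))

/-- The separable part is modular: the double increment has the same pair defect as `φ`. [folklore] -/
theorem doubleIncrement_defect (φ : (Fin 2 → ℝ) → ℝ) (b x y : Fin 2 → ℝ) :
    (φ x - φ ![x 0, b 1] - φ ![b 0, x 1] + φ b) + (φ y - φ ![y 0, b 1] - φ ![b 0, y 1] + φ b) -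
      ((φ (x ⊓ y) - φ ![(x ⊓ y) 0, b 1] - φ ![b 0, (x ⊓ y) 1] + φ b) +
        (φ (x ⊔ y) - φ ![(x ⊔ y) 0, b 1] - φ ![b 0, (x ⊔ y) 1] + φ b)) =
      φ x + φ y - (φ (x ⊓ y) + φ (x ⊔ y)) := by
  have h0 := apply_min_add_apply_max (fun s => φ ![s, b 1]) (x 0) (y 0)
  have h1 := apply_min_add_apply_max (fun t => φ ![b 0, t]) (x 1) (y 1)
  simp only [Pi.inf_apply, Pi.sup_apply] at h0 h1 ⊢
  linarith

/-- **The quadrant package.**  For a measurable `φ : ℝ² → ℝ` satisfying the rectangle inequality almost everywhere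
and almost every base point `b`, the double increment `D_b(x) = φ(x) − φ(x₀, b₁) − φ(b₀, x₁) + φ(b)` has, on the
open quadrant `Q = {x₀ > b₀, x₁ > b₁}`, a measurable version which is supermodular at every pair of `Q`,
non-decreasing at every comparable pair of `Q` and non-negative on `Q`. [this work] -/
theorem quadrant_version (φ : (Fin 2 → ℝ) → ℝ) (hφ : Measurable φ)
    (hR : ∀ᵐ p : (Fin 2 → ℝ) × (Fin 2 → ℝ) ∂((volume : Measure (Fin 2 → ℝ)).prod volume),
      φ ![min (p.1 0) (p.2 0), max (p.1 1) (p.2 1)] + φ ![max (p.1 0) (p.2 0), min (p.1 1) (p.2 1)] ≤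
        φ (p.1 ⊓ p.2) + φ (p.1 ⊔ p.2)) :
    ∀ᵐ b ∂(volume : Measure (Fin 2 → ℝ)), ∃ G : (Fin 2 → ℝ) → ℝ, Measurable G ∧
      (∀ᵐ x ∂(volume : Measure (Fin 2 → ℝ)), b 0 < x 0 → b 1 < x 1 →
        G x = φ x - φ ![x 0, b 1] - φ ![b 0, x 1] + φ b) ∧
      (∀ x y : Fin 2 → ℝ, b 0 < x 0 → b 1 < x 1 → b 0 < y 0 → b 1 < y 1 → G x + G y ≤ G (x ⊓ y) + G (x ⊔ y)) ∧
      (∀ x y : Fin 2 → ℝ, b 0 < x 0 → b 1 < x 1 → x ≤ y → G x ≤ G y) ∧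
      (∀ x : Fin 2 → ℝ, b 0 < x 0 → b 1 < x 1 → 0 ≤ G x) := by
  set R : (Fin 2 → ℝ) → (Fin 2 → ℝ) → Prop := fun u v =>
    φ ![min (u 0) (v 0), max (u 1) (v 1)] + φ ![max (u 0) (v 0), min (u 1) (v 1)] ≤ φ (u ⊓ v) + φ (u ⊔ v) with hRdef
  -- generic base points
  have A1 : ∀ᵐ b ∂(volume : Measure (Fin 2 → ℝ)), ∀ᵐ x ∂(volume : Measure (Fin 2 → ℝ)), R b x :=
    Measure.ae_ae_of_ae_prod hR
  have A2 : ∀ᵐ b ∂(volume : Measure (Fin 2 → ℝ)),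
      ∀ᵐ p : (Fin 2 → ℝ) × (Fin 2 → ℝ) ∂((volume : Measure (Fin 2 → ℝ)).prod volume), R ![p.1 0, b 1] p.2 := by
    have h := ae_coord_of_ae 1 (ae_ae_coord_one (S := R) hR)
    filter_upwards [h] with b hb
    exact ae_pair_of_ae_coord_pair (T := fun s v => R ![s, b 1] v) 0 hb
  have A3 : ∀ᵐ b ∂(volume : Measure (Fin 2 → ℝ)),
      ∀ᵐ p : (Fin 2 → ℝ) × (Fin 2 → ℝ) ∂((volume : Measure (Fin 2 → ℝ)).prod volume), R ![b 0, p.2 1] p.1 := by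
    have h := ae_coord_of_ae 0 (ae_ae_coord_zero (S := R) hR)
    filter_upwards [h] with b hb
    exact ae_pair_of_ae_coord_pair_swap (T := fun t v => R ![b 0, t] v) 1 hb
  filter_upwards [A1, A2, A3] with b h1 h2 h3
  -- the base point is fixed from now on
  obtain ⟨s₀, t₀, rfl⟩ : ∃ s₀ t₀ : ℝ, b = ![s₀, t₀] := ⟨b 0, b 1, eta' b⟩
  simp only [vec_zero', vec_one'] at h1 h2 h3 ⊢
  set Q : Set (Fin 2 → ℝ) := {x | s₀ < x 0 ∧ t₀ < x 1} with hQ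
  have mQ : MeasurableSet Q := measurableSet_quadrant ![s₀, t₀]
  set D : (Fin 2 → ℝ) → ℝ := fun x => φ x - φ ![x 0, t₀] - φ ![s₀, x 1] + φ ![s₀, t₀] with hD
  have hDm : Measurable D :=
    ((hφ.sub (hφ.comp (measurable_vec_fst t₀))).sub (hφ.comp (measurable_vec_snd s₀))).add measurable_const
  have hQinf : ∀ x ∈ Q, ∀ y ∈ Q, x ⊓ y ∈ Q := fun x hx y hy =>
    ⟨lt_min hx.1 hy.1, lt_min hx.2 hy.2⟩
  have hQsup : ∀ x ∈ Q, ∀ y ∈ Q, x ⊔ y ∈ Q := fun x hx y hy =>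
    ⟨hx.1.trans_le (le_max_left _ _), hx.2.trans_le (le_max_left _ _)⟩
  have hQup : ∀ x ∈ Q, ∀ y, x ≤ y → y ∈ Q := fun x hx y hxy =>
    ⟨hx.1.trans_le (hxy 0), hx.2.trans_le (hxy 1)⟩
  -- (a) `D ≥ 0` a.e. on `Q`
  have hD0 : ∀ᵐ x ∂(volume : Measure (Fin 2 → ℝ)), x ∈ Q → 0 ≤ D x := by
    filter_upwards [h1] with x hx hxQ
    obtain ⟨a, c, rfl⟩ : ∃ a c : ℝ, x = ![a, c] := ⟨x 0, x 1, eta' x⟩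
    simp only [hQ, Set.mem_setOf_eq, vec_zero', vec_one'] at hxQ
    simp only [hRdef, vec_zero', vec_one', vec_inf_vec, vec_sup_vec, min_eq_left hxQ.1.le, max_eq_right hxQ.2.le,
      max_eq_right hxQ.1.le, min_eq_left hxQ.2.le] at hx
    simp only [hD, vec_zero', vec_one']
    linarith
  -- (b) `D` non-decreasing on a.e. comparable pair of `Q`
  have hDmono : ∀ᵐ p : (Fin 2 → ℝ) × (Fin 2 → ℝ) ∂((volume : Measure (Fin 2 → ℝ)).prod volume),
      p.1 ∈ Q → p.2 ∈ Q → p.1 ≤ p.2 → D p.1 ≤ D p.2 := by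
    filter_upwards [h2, h3] with p hp2 hp3 hxQ hyQ hxy
    obtain ⟨x, y⟩ := p
    obtain ⟨a, c, rfl⟩ : ∃ a c : ℝ, x = ![a, c] := ⟨x 0, x 1, eta' x⟩
    obtain ⟨a', c', rfl⟩ : ∃ a' c' : ℝ, y = ![a', c'] := ⟨y 0, y 1, eta' y⟩
    simp only [hQ, Set.mem_setOf_eq, vec_zero', vec_one'] at hxQ hyQ
    have h0 : a ≤ a' := hxy 0
    have h1' : c ≤ c' := hxy 1
    simp only [hRdef, vec_zero', vec_one', vec_inf_vec, vec_sup_vec, min_eq_left h0, max_eq_right h0,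
      min_eq_left hyQ.2.le, max_eq_right hyQ.2.le] at hp2
    simp only [hRdef, vec_zero', vec_one', vec_inf_vec, vec_sup_vec, min_eq_left hxQ.1.le, max_eq_right hxQ.1.le,
      max_eq_left h1', min_eq_right h1'] at hp3
    simp only [hD, vec_zero', vec_one']
    linarith
  -- (c) the pair defect of `D` is that of `φ`
  have hDdef : ∀ x y, D x + D y - (D (x ⊓ y) + D (x ⊔ y)) = φ x + φ y - (φ (x ⊓ y) + φ (x ⊔ y)) := fun x y => by
    simp only [hD]
    have := doubleIncrement_defect φ ![s₀, t₀] x y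
    simp only [vec_zero', vec_one'] at this
    linarith
  -- the density `g = 𝟙_Q · exp D`
  set g : (Fin 2 → ℝ) → ℝ≥0∞ := Q.indicator fun x => ENNReal.ofReal (Real.exp (D x)) with hg
  have hgm : Measurable g := (ENNReal.measurable_ofReal.comp (Real.measurable_exp.comp hDm)).indicator mQ
  have hg_of_mem : ∀ x ∈ Q, g x = ENNReal.ofReal (Real.exp (D x)) := fun x hx => Set.indicator_of_mem hx _
  have hg_of_not_mem : ∀ x ∉ Q, g x = 0 := fun x hx => Set.indicator_of_notMem hx _
  have hgMTP : ∀ᵐ p : (Fin 2 → ℝ) × (Fin 2 → ℝ) ∂((volume : Measure (Fin 2 → ℝ)).prod volume),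
      g p.1 * g p.2 ≤ g (p.1 ⊓ p.2) * g (p.1 ⊔ p.2) := by
    filter_upwards [hR] with p hp
    by_cases hx : p.1 ∈ Q
    · by_cases hy : p.2 ∈ Q
      · rw [hg_of_mem _ hx, hg_of_mem _ hy, hg_of_mem _ (hQinf _ hx _ hy), hg_of_mem _ (hQsup _ hx _ hy),
          ← ENNReal.ofReal_mul (Real.exp_pos _).le, ← ENNReal.ofReal_mul (Real.exp_pos _).le, ← Real.exp_add,
          ← Real.exp_add]
        refine ENNReal.ofReal_le_ofReal (Real.exp_le_exp.2 ?_)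
        have h' := supermodular_of_rect_pointwise hp
        linarith [hDdef p.1 p.2]
      · rw [hg_of_not_mem _ hy, mul_zero]; exact zero_le
    · rw [hg_of_not_mem _ hx, zero_mul]; exact zero_le
  have hgmono : ∀ᵐ p : (Fin 2 → ℝ) × (Fin 2 → ℝ) ∂((volume : Measure (Fin 2 → ℝ)).prod volume),
      p.1 ≤ p.2 → g p.1 ≤ g p.2 := by
    filter_upwards [hDmono] with p hp hle
    by_cases hx : p.1 ∈ Q
    · have hy : p.2 ∈ Q := hQup _ hx _ hle
      rw [hg_of_mem _ hx, hg_of_mem _ hy]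
      exact ENNReal.ofReal_le_ofReal (Real.exp_le_exp.2 (hp hx hy hle))
    · rw [hg_of_not_mem _ hx]; exact zero_le
  -- local essential bounds below every point, from a generic larger point
  have hmono2 : ∀ᵐ y ∂(volume : Measure (Fin 2 → ℝ)), ∀ᵐ x ∂(volume : Measure (Fin 2 → ℝ)),
      x ∈ Q → y ∈ Q → x ≤ y → D x ≤ D y := by
    have hsw := (Measure.measurePreserving_swap (μ := (volume : Measure (Fin 2 → ℝ)))
      (ν := (volume : Measure (Fin 2 → ℝ)))).quasiMeasurePreserving.ae hDmono
    exact Measure.ae_ae_of_ae_prod (p := fun z : (Fin 2 → ℝ) × (Fin 2 → ℝ) =>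
      z.2 ∈ Q → z.1 ∈ Q → z.2 ≤ z.1 → D z.2 ≤ D z.1) hsw
  have hloc : ∀ q : Fin 2 → ℝ, ∃ M : ℝ≥0∞, M ≠ ∞ ∧
      ∀ᵐ z ∂(volume : Measure (Fin 2 → ℝ)), z ≤ q → g z ≤ M := by
    intro q
    set m : Fin 2 → ℝ := fun i => max (q i) (![s₀, t₀] i) + 1 with hm
    set B : Set (Fin 2 → ℝ) := Set.pi univ fun i => Ioc (m i - 1) (m i) with hB
    have hB0 : volume B ≠ 0 := by
      rw [hB, volume_lowerCorner]; simp
    have hBQ : ∀ y ∈ B, y ∈ Q ∧ q ≤ y := by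
      intro y hy
      rw [Set.mem_univ_pi] at hy
      have h0 := (hy 0).1; have h1 := (hy 1).1
      simp only [hm, vec_zero', vec_one', add_sub_cancel_right, max_lt_iff] at h0 h1
      refine ⟨⟨h0.2, h1.2⟩, fun i => ?_⟩
      fin_cases i
      · exact h0.1.le
      · exact h1.1.le
    obtain ⟨y, hyB, hy⟩ : ∃ y ∈ B, ∀ᵐ x ∂(volume : Measure (Fin 2 → ℝ)), x ∈ Q → y ∈ Q → x ≤ y → D x ≤ D y := by
      by_contra hne
      apply hB0
      refine measure_mono_null (fun y hy => ?_) (ae_iff.1 hmono2)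
      intro hy'
      exact hne ⟨y, hy, hy'⟩
    refine ⟨ENNReal.ofReal (Real.exp (D y)), ENNReal.ofReal_ne_top, ?_⟩
    filter_upwards [hy] with z hz hzq
    by_cases hzQ : z ∈ Q
    · rw [hg_of_mem _ hzQ]
      exact ENNReal.ofReal_le_ofReal (Real.exp_le_exp.2 (hz hzQ (hBQ y hyB).1 (hzq.trans (hBQ y hyB).2)))
    · rw [hg_of_not_mem _ hzQ]; exact zero_le
  -- the envelope
  obtain ⟨F, hFm, hFb, hFg, hFmtp, hFmono⟩ :=
    exists_measurable_monotone_mtp2_version_of_ae_local g hgm (c₀ := 0) (fun _ => zero_le) hloc hgMTP hgmono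
  -- `F ≥ 1` on `Q`
  have hF1 : ∀ p ∈ Q, 1 ≤ F p := by
    intro p hp
    set r : ℝ := min (p 0 - s₀) (p 1 - t₀) with hr
    have hr0 : 0 < r := lt_min (sub_pos.2 hp.1) (sub_pos.2 hp.2)
    set C : Set (Fin 2 → ℝ) := Set.pi univ fun i => Ioc (p i - r) (p i) with hC
    have hC0 : volume C ≠ 0 := by
      rw [hC, volume_lowerCorner]
      exact pow_ne_zero _ (ENNReal.ofReal_pos.2 hr0).ne'
    have hCQ : ∀ z ∈ C, z ∈ Q ∧ z ≤ p := by
      intro z hz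
      refine ⟨⟨?_, ?_⟩, le_of_mem_lowerCorner hz⟩
      · have := (Set.mem_univ_pi.1 hz 0).1
        have hr' : r ≤ p 0 - s₀ := min_le_left _ _
        linarith
      · have := (Set.mem_univ_pi.1 hz 1).1
        have hr' : r ≤ p 1 - t₀ := min_le_right _ _
        linarith
    obtain ⟨z, hzC, hzF, hzD⟩ : ∃ z ∈ C, F z = g z ∧ (z ∈ Q → 0 ≤ D z) := by
      by_contra hne
      apply hC0
      refine measure_mono_null (fun z hz => ?_) (ae_iff.1 (hFg.and hD0))
      intro h
      exact hne ⟨z, hz, h.1, h.2⟩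
    have hzQ := (hCQ z hzC).1
    calc (1 : ℝ≥0∞) = ENNReal.ofReal (Real.exp 0) := by rw [Real.exp_zero, ENNReal.ofReal_one]
      _ ≤ g z := by
          rw [hg_of_mem _ hzQ]; exact ENNReal.ofReal_le_ofReal (Real.exp_le_exp.2 (hzD hzQ))
      _ = F z := hzF.symm
      _ ≤ F p := hFmono (hCQ z hzC).2
  have hFT : ∀ x, F x ≠ ∞ := fun x => (hFb x).2
  have hFpos : ∀ x ∈ Q, 0 < (F x).toReal := fun x hx =>
    ENNReal.toReal_pos (ne_of_gt (lt_of_lt_of_le zero_lt_one (hF1 x hx))) (hFT x)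
  have hF1' : ∀ x ∈ Q, 1 ≤ (F x).toReal := fun x hx => by
    have := ENNReal.toReal_mono (hFT x) (hF1 x hx)
    rwa [ENNReal.toReal_one] at this
  -- the version `G = log F`
  refine ⟨fun x => Real.log (F x).toReal, Real.measurable_log.comp (ENNReal.measurable_toReal.comp hFm),
    ?_, fun x y hx0 hx1 hy0 hy1 => ?_, fun x y hx0 hx1 hxy => ?_, fun x hx0 hx1 => Real.log_nonneg (hF1' x ⟨hx0, hx1⟩)⟩
  · filter_upwards [hFg] with x hx hx0 hx1
    show Real.log (F x).toReal = φ x - φ ![x 0, t₀] - φ ![s₀, x 1] + φ ![s₀, t₀]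
    rw [hx, hg_of_mem x ⟨hx0, hx1⟩, ENNReal.toReal_ofReal (Real.exp_pos _).le, Real.log_exp]
  · have hx : x ∈ Q := ⟨hx0, hx1⟩
    have hy : y ∈ Q := ⟨hy0, hy1⟩
    have h := hFmtp x y
    have hL : (F x * F y).toReal ≤ (F (x ⊓ y) * F (x ⊔ y)).toReal :=
      ENNReal.toReal_mono (ENNReal.mul_ne_top (hFT _) (hFT _)) h
    rw [ENNReal.toReal_mul, ENNReal.toReal_mul] at hL
    rw [← Real.log_mul (hFpos x hx).ne' (hFpos y hy).ne',
      ← Real.log_mul (hFpos _ (hQinf x hx y hy)).ne' (hFpos _ (hQsup x hx y hy)).ne']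
    exact Real.log_le_log (mul_pos (hFpos x hx) (hFpos y hy)) hL
  · have hx : x ∈ Q := ⟨hx0, hx1⟩
    have hy : y ∈ Q := hQup x hx y hxy
    exact Real.log_le_log (hFpos x hx) (ENNReal.toReal_mono (hFT y) (hFmono hxy))

end Summit.CriticalPhenomena.PercolationContinuityZ3.Theorems.SahiAEFourFunctions.Plane
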